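import Summits.ABC.IUTFork.ForkGenuineDepthFamily
import Literature.IUT.LogVolume.GenuineLogThetaExactVolumeInput
import HarnessLib

/-!
# The fork at [IUTchIII] Corollary 3.12 at a GENUINE input: along the synthetic depth family the typed inequality is
# an EXACT AFFINE THRESHOLD in the depth (skeleton XXVIId)

Record-only file (D-0012) of the abc-iut cell (deliverable (a), skeleton seat abc-iut-skel, gen 8); TAKES NO SIDE.
Sequel to `ForkGenuineDepthFamily.lean` (skel gen 7, p427940: along abc-iut-w5-d157's synthetic Θ-volume inputs
`ThetaVolumeInput.deepAt p l N σ` — `j_E := p^{−2lN}`, `S := V(F₀)_p`, ideles `t_{Θ,j,v} := p^{j²N}`, `t_{q,v} := p^N` in the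
GENUINE completions `K_{v̲}` — the cell's typed `Cor312Of` is TRUE at small depth and FALSE at some depth). There the two sides
came from two ESTIMATES (free inequality + archimedean term below; [IUTchIV] Step (v) discrepancy above), leaving open what
happens between the two thresholds («in between, the contents decide», `HOME/skel/FORK-INDEX.md` row 2). HERE the contents are
decided EXACTLY for this family, with abc-iut-c312-3's exact content formula (`ThetaVolumeInput.negLogThetaLoc_eq_of_content`)
and abc-iut-w5-d180's orbit-content algebra (`exists_content`, `content_unique`):

* §1 packet algebra: a slot union of SCALARS `⋃_a ι_a(c)·A` is `c·A` (`iUnion_iota_smul_eq_smul_of_eq_algebraMap`); rescaling by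
  `p^n` SHIFTS the content by `n` (`content_shift`); `(R_I)^∼` has a content (`exists_content_normalizedPacket`);
* `slotUnion_deepAt_eq` — at a tuple `v⃗` over the deep prime, in degree `j = i+1`, the slot union of the synthetic Θ-idele is
  `p^{j²N}·(R_{v⃗})^∼` (the idele is the RATIONAL scalar `p^{j²N}` in every slot);
* **`negLogThetaLoc_deepAt_sub`**, **`negLogThetaNonarch_deepAt_sub`** — the genuine `−|log(Θ)|^nonarch` is EXACTLY AFFINE in
  the depth: `negLogThetaNonarch (deepAt N) − negLogThetaNonarch (deepAt N') = −((l+1)l/12)·(N − N')·log p` (at `p` the content of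
  the slot union is `j²N + content((R_{v⃗})^∼)`, `Σ_{v⃗} Π Pr = 1`, `(1/ℓ⋇)Σ_j j² = (l+1)l/12`; the other summands do not move);
* **`cor312Of_deepAt_iff`** — THE THRESHOLD LAW: for every `F₀, K, σ, p`, prime `l ≥ 5`, depth `N ≥ 1`,
  `Cor312Of (deepAt p l N σ) ↔ ((l+1)l/12 − 1)·N·log p ≤ negLogTheta (deepAt p l 1 σ) + ((l+1)l/12)·log p`; so the typed
  inequality is ANTITONE in the depth (`cor312Of_deepAt_anti`), `↔ N ≤ N₀(p,l,σ)` (`cor312Of_deepAt_iff_le_threshold`), and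
  **`exists_nat_threshold`**: `∃ N₀ : ℕ, ∀ N ≥ 1, Cor312Of (deepAt N) ↔ N ≤ N₀` — ONE crossing; `N₀ ≥ 1` at `(l,p) = (5,2), (5,3),
  (7,2)` by skel gen 7's instances (`exists_pos_nat_threshold_five_two`, `…_five_three_and_seven_two`).

READING (grammar of `HOME/skel/FORK-REAL-MODEL.md` §4/§9; no side taken): along this family the (Ind1)/(Ind2)+hull inflation of the
sharp Θ-region does NOT depend on the depth (the ideles are scalars, so the indeterminacy orbit is the orbit of `(R_I)^∼` rescaled),
while the gap `deĝ̲_lgp(P_Θ) − deĝ̲(P_q) = ((l+1)l/12 − 1)·N·log p` grows linearly: the typed inequality of [IUTchIII] Cor. 3.12 holds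
exactly until the linear gap overtakes the constant inflation and fails beyond — «the contents decide» is a closed formula here.
HONEST SCOPE (as in the parents): inhabitants of the INPUT TYPE with genuine completions but SYNTHETIC ideles, NOT the Θ-volume inputs
of initial Θ-data of [IUTchI] Def. 3.1; sharp (Ind3), full (Ind1)/(Ind2), Mochizuki's container ((Ind2)/the hull are the tree's typings
of disputed-corpus constructions). Nothing here bears on whether [IUTchIII] Thm. 3.11 licenses Cor. 3.12; typed ≠ proved. PROOF-ONLY
file: no definitions, no `Prop` facts. [cite: DupuyHilado2025, §1 (1.1), Def. 3.6.3, §3.3, §3.9, §4.9, §4.12, Thm. 3.10.1]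
[cite: Mochizuki2012, IUTchIII Cor. 3.12 p. 173–174] [cite: Mochizuki2012, IUTchIV Thm. 1.10 Step (v)–(vii) p. 27–30]
[cite: WeilBNT1967, Ch. II §2, Th. 2] [claim: Mochizuki2012, status: disputed]
-/

noncomputable section

open Set Module Literature.IUT.LogVolume NumberField IsDedekindDomain
open scoped Pointwise

namespace Summit.ABC.IUTFork.GenuineContent

/-! ## §1 Packet algebra: slot unions of scalars, the content shift, the content of `(R_I)^∼` -/

section Packet

variable (p : ℕ) [Fact p.Prime] {ι : Type} [Fintype ι] [DecidableEq ι] [Nonempty ι]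
variable (k : ι → Type) [∀ i, NontriviallyNormedField (k i)] [∀ i, NormedAlgebra ℚ_[p] (k i)]
  [∀ i, IsUltrametricDist (k i)] [∀ i, ProperSpace (k i)]

omit [Fintype ι] [∀ i, IsUltrametricDist (k i)] [∀ i, ProperSpace (k i)] in
/-- **A slot union of SCALARS is one rescaled region**: if every slot carries the image of the same `c ∈ ℚ_p`, then
`⋃_a ι_a(g_a)·A = c·A` (`ι_a` is a `ℚ_p`-algebra map, so `ι_a(c) = c·1`). [cite: DupuyHilado2025, §4.7, §4.9] -/
theorem iUnion_iota_smul_eq_smul_of_eq_algebraMap (c : ℚ_[p]) (g : (i : ι) → k i)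
    (hg : ∀ i, g i = algebraMap ℚ_[p] (k i) c) (A : Set (PacketAlgebra p k)) :
    (⋃ i, iota p k i (g i) • A) = c • A := by
  have h : ∀ i, iota p k i (g i) • A = c • A := by
    intro i
    rw [hg i, AlgHom.commutes]
    ext y
    simp only [Set.mem_smul_set, algebraMap_smul]
  rw [Set.iUnion_congr h, Set.iUnion_const]

omit [Fintype ι] [DecidableEq ι] [Nonempty ι] [∀ i, IsUltrametricDist (k i)] [∀ i, ProperSpace (k i)] in
/-- **The content SHIFTS under rescaling by `p^n`**: if `M ⊆ p^m·log_p(R_I^×)` and `M ⊄ p^{m+1}·log_p(R_I^×)` then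
`p^n·M ⊆ p^{m+n}·log_p(R_I^×)` and `p^n·M ⊄ p^{m+n+1}·log_p(R_I^×)`. [cite: WeilBNT1967, Ch. II §2, Th. 2] -/
theorem content_shift {M : Set (PacketAlgebra p k)} {m : ℤ} (n : ℤ)
    (hm : M ⊆ ((p : ℚ_[p]) ^ m) • (logPacket p k : Set (PacketAlgebra p k)))
    (hm1 : ¬ M ⊆ ((p : ℚ_[p]) ^ (m + 1)) • (logPacket p k : Set (PacketAlgebra p k))) :
    ((p : ℚ_[p]) ^ n) • M ⊆ ((p : ℚ_[p]) ^ (m + n)) • (logPacket p k : Set (PacketAlgebra p k)) ∧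
      ¬ ((p : ℚ_[p]) ^ n) • M ⊆ ((p : ℚ_[p]) ^ (m + n + 1)) • (logPacket p k : Set (PacketAlgebra p k)) := by
  have hp0 : (p : ℚ_[p]) ≠ 0 := Nat.cast_ne_zero.mpr (Fact.out : p.Prime).ne_zero
  refine ⟨?_, fun h => hm1 ?_⟩
  · calc ((p : ℚ_[p]) ^ n) • M
        ⊆ ((p : ℚ_[p]) ^ n) • (((p : ℚ_[p]) ^ m) • (logPacket p k : Set (PacketAlgebra p k))) :=
          Set.smul_set_mono hm
      _ = ((p : ℚ_[p]) ^ (m + n)) • (logPacket p k : Set (PacketAlgebra p k)) := by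
          rw [smul_smul, ← zpow_add₀ hp0, add_comm]
  · have h2 : M = ((p : ℚ_[p]) ^ (-n)) • (((p : ℚ_[p]) ^ n) • M) := by
      rw [smul_smul, ← zpow_add₀ hp0, neg_add_cancel, zpow_zero, one_smul]
    rw [h2]
    calc ((p : ℚ_[p]) ^ (-n)) • (((p : ℚ_[p]) ^ n) • M)
        ⊆ ((p : ℚ_[p]) ^ (-n)) • (((p : ℚ_[p]) ^ (m + n + 1)) • (logPacket p k : Set (PacketAlgebra p k))) :=
          Set.smul_set_mono h
      _ = ((p : ℚ_[p]) ^ (m + 1)) • (logPacket p k : Set (PacketAlgebra p k)) := by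
          rw [smul_smul, ← zpow_add₀ hp0, show -n + (m + n + 1) = m + 1 by ring]

/-- **`(R_I)^∼` has a content** w.r.t. `log_p(R_I^×)` (bounded; contains `ι(1) ≠ 0`). [cite: WeilBNT1967, Ch. II §2, Th. 2] -/
theorem exists_content_normalizedPacket :
    ∃ m : ℤ, (normalizedPacket p k : Set (PacketAlgebra p k)) ⊆
        ((p : ℚ_[p]) ^ m) • (logPacket p k : Set (PacketAlgebra p k)) ∧
      ¬ (normalizedPacket p k : Set (PacketAlgebra p k)) ⊆
        ((p : ℚ_[p]) ^ (m + 1)) • (logPacket p k : Set (PacketAlgebra p k)) := by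
  have hb : IsPsiBounded p k (normalizedPacket p k : Set (PacketAlgebra p k)) := by
    simpa only [one_smul] using isPsiBounded_smul_normalizedPacket p k (1 : PacketAlgebra p k)
  obtain ⟨i⟩ := ‹Nonempty ι›
  refine exists_content p k hb ⟨iota p k i 1, ?_, (map_ne_zero (iota p k i)).mpr one_ne_zero⟩
  rw [map_one]
  exact Subring.one_mem _

end Packet

/-! ## §2 The synthetic depth family: slot unions, the affine law, the threshold -/

section DepthThreshold

variable {F₀ : Type} [Field F₀] [NumberField F₀] {K : Type} [Field K] [NumberField K] [Algebra F₀ K]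
variable (p : ℕ) [hp : Fact p.Prime] (l : ℕ) (hl : l.Prime) (h5 : 5 ≤ l) (σ : PlaceSection F₀ K)

/-- The synthetic Θ-idele at a place over the deep prime, as a field element: `t_{Θ,j,v} = p^{j²N}` (the image of `p^{j²N} ∈ ℚ_p`).
[cite: DupuyHilado2025, §3.9] -/
theorem coe_tΘ_deepAt (N : ℕ) (hN : 0 < N) (i : Fin (ThetaVolumeInput.deepAt p l hl h5 N hN σ).lstar)
    (v : placesOver F₀ p) :
    ((ThetaVolumeInput.deepAt p l hl h5 N hN σ).tΘ p hp.out i v).val =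
      algebraMap ℚ_[p] (((ThetaVolumeInput.deepAt p l hl h5 N hN σ).σ.localFieldFamily p hp.out).k v)
        ((p : ℚ_[p]) ^ (((i : ℕ) + 1) ^ 2 * N)) := by
  rw [map_pow, map_natCast]
  simp only [ThetaVolumeInput.deepAt, if_pos v.2, Units.val_pow_eq_pow_val, LocalFields.primeUnit', Units.val_mk0]
  rfl

/-- **The slot union of the synthetic Θ-idele at a tuple over the deep prime is `p^{j²N}·(R_{v⃗})^∼`** (`j = i+1`).
[cite: DupuyHilado2025, §3.9, §4.7] -/
theorem slotUnion_deepAt_eq (N : ℕ) (hN : 0 < N) (i : Fin (ThetaVolumeInput.deepAt p l hl h5 N hN σ).lstar)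
    (e : Fin ((i : ℕ) + 1 + 1) → placesOver F₀ p) :
    (⋃ a : Fin ((i : ℕ) + 1 + 1),
        iota p (fun b => ((ThetaVolumeInput.deepAt p l hl h5 N hN σ).σ.localFieldFamily p hp.out).k (e b)) a
            ((ThetaVolumeInput.deepAt p l hl h5 N hN σ).tΘ p hp.out i (e a)).val •
          (normalizedPacket p (fun b => ((ThetaVolumeInput.deepAt p l hl h5 N hN σ).σ.localFieldFamily p hp.out).k (e b)) :
            Set (PacketAlgebra p
              (fun b => ((ThetaVolumeInput.deepAt p l hl h5 N hN σ).σ.localFieldFamily p hp.out).k (e b))))) =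
      ((p : ℚ_[p]) ^ (((((i : ℕ) + 1) ^ 2 * N : ℕ) : ℤ))) •
        (normalizedPacket p (fun b => (σ.localFieldFamily p hp.out).k (e b)) :
          Set (PacketAlgebra p (fun b => (σ.localFieldFamily p hp.out).k (e b)))) := by
  rw [zpow_natCast]
  exact iUnion_iota_smul_eq_smul_of_eq_algebraMap p
    (fun b => ((ThetaVolumeInput.deepAt p l hl h5 N hN σ).σ.localFieldFamily p hp.out).k (e b))
    ((p : ℚ_[p]) ^ (((i : ℕ) + 1) ^ 2 * N)) _ (fun a => coe_tΘ_deepAt p l hl h5 σ N hN i (e a)) _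

include hl h5 in
/-- `(1/ℓ⋇)·Σ_{j=1}^{ℓ⋇} j² = (l+1)·l/12` for `ℓ⋇ = (l−1)/2`, `l` an odd prime `≥ 5` (`Σ j² = ℓ⋇(ℓ⋇+1)(2ℓ⋇+1)/6`, `2ℓ⋇+1 = l`).
[cite: DupuyHilado2025, §3.3] -/
theorem avg_sum_sq_eq :
    (1 / (((l - 1) / 2 : ℕ) : ℝ)) * ∑ i : Fin ((l - 1) / 2), (((i : ℕ) : ℝ) + 1) ^ 2 = ((l : ℝ) + 1) * l / 12 := by
  set L : ℕ := (l - 1) / 2 with hLdef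
  have h2 : 2 * L = l - 1 := by
    obtain ⟨r, hr⟩ := hl.odd_of_ne_two (by omega)
    omega
  have h2L : (2 : ℝ) * L = (l : ℝ) - 1 := by
    have h1 : 1 ≤ l := by omega
    have : ((2 * L : ℕ) : ℝ) = ((l - 1 : ℕ) : ℝ) := by rw [h2]
    push_cast [Nat.cast_sub h1] at this
    linarith
  have hL0 : (L : ℝ) ≠ 0 := by
    have : 2 ≤ L := by omega
    positivity
  have hS : 6 * ∑ i : Fin L, (((i : ℕ) : ℝ) + 1) ^ 2 = (L : ℝ) * ((L : ℝ) + 1) * (2 * (L : ℝ) + 1) := by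
    rw [Fin.sum_univ_eq_sum_range (fun i => ((i : ℝ) + 1) ^ 2) L]
    clear hLdef h2 h2L hL0
    induction L with
    | zero => simp
    | succ n ih =>
      rw [Finset.sum_range_succ, mul_add, ih]
      push_cast
      ring
  have hS' : ∑ i : Fin L, (((i : ℕ) : ℝ) + 1) ^ 2 = (L : ℝ) * (((l : ℝ) + 1) * l / 12) := by
    have e1 : (L : ℝ) + 1 = ((l : ℝ) + 1) / 2 := by linarith
    have e2 : 2 * (L : ℝ) + 1 = l := by linarith
    rw [e1, e2] at hS
    linear_combination hS / 6
  rw [hS']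
  field_simp

/-- **THE `p`-SUMMAND OF `−|log(Θ)|` IS EXACTLY AFFINE IN THE DEPTH**: for every `F₀, K, σ`, prime `p`, prime `l ≥ 5` and
depths `N, N' ≥ 1`, `negLogThetaLoc (deepAt p l N σ) p − negLogThetaLoc (deepAt p l N' σ) p = −((l+1)l/12)·(N − N')·log p`
(the content of the slot union `p^{j²N}·(R_{v⃗})^∼` is `j²N +` the content of `(R_{v⃗})^∼`, so in abc-iut-c312-3's exact content
formula only the term `−j²N·log p·Π Pr` depends on `N`; `Σ_{v⃗} Π Pr = 1`; `(1/ℓ⋇)Σ_j j² = (l+1)l/12`).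
[cite: DupuyHilado2025, §1 (1.1), Def. 3.6.3, §4.12] [cite: WeilBNT1967, Ch. II §2, Th. 2] [claim: Mochizuki2012, status: disputed] -/
theorem negLogThetaLoc_deepAt_sub (N N' : ℕ) (hN : 0 < N) (hN' : 0 < N') :
    (ThetaVolumeInput.deepAt p l hl h5 N hN σ).negLogThetaLoc p -
        (ThetaVolumeInput.deepAt p l hl h5 N' hN' σ).negLogThetaLoc p =
      -(((l : ℝ) + 1) * l / 12 * (((N : ℝ) - N') * Real.log p)) := by
  classical
  -- the depth-free contents `m₀(v⃗)` of the unit balls `(R_{v⃗})^∼`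
  have hex := fun (i : Fin ((l - 1) / 2)) (e : Fin ((i : ℕ) + 1 + 1) → placesOver F₀ p) =>
    exists_content_normalizedPacket p (fun b => (σ.localFieldFamily p hp.out).k (e b))
  choose m₀ hm₀ hm₀' using hex
  -- `Σ_{v⃗} Π Pr(v_b) = (Σ_v Pr(v))^{j+1} = 1`
  have hsum : ∑ v : placesOver F₀ p, weight F₀ v.1 = 1 := (localWeights F₀ p).sum_pr
  have hW : ∀ n : ℕ, ∑ e : Fin n → placesOver F₀ p, ∏ b, weight F₀ (e b).1 = 1 := by
    intro n
    have h := Finset.prod_univ_sum (t := fun _ : Fin n => (Finset.univ : Finset (placesOver F₀ p)))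
      (f := fun _ v => weight F₀ v.1)
    rw [Fintype.piFinset_univ] at h
    rw [← h, hsum, Finset.prod_const_one]
  -- per-term algebra: isolate the `N`-dependence
  have hterm : ∀ (i : Fin ((l - 1) / 2)) (M : ℕ) (m : ℤ) (H W : ℝ),
      (-(((m + ((((i : ℕ) + 1) ^ 2 * M : ℕ) : ℤ) : ℤ) : ℝ) * Real.log p) + H) * W =
        (-((m : ℝ) * Real.log p) + H) * W - ((((i : ℕ) : ℝ) + 1) ^ 2 * ((M : ℝ) * Real.log p)) * W := by
    intro i M m H W
    push_cast
    ring
  -- the exact content formula at depth `M` with the content family `m₀ + j²M`, in closed form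
  have key : ∀ (M : ℕ) (hM : 0 < M), (ThetaVolumeInput.deepAt p l hl h5 M hM σ).negLogThetaLoc p =
      (1 / (((l - 1) / 2 : ℕ) : ℝ)) * ∑ i : Fin ((l - 1) / 2), ∑ e : Fin ((i : ℕ) + 1 + 1) → placesOver F₀ p,
        (-((m₀ i e : ℝ) * Real.log p) +
          packetLogμ p (fun b => (σ.localFieldFamily p hp.out).k (e b))
            (packetHull p (fun b => (σ.localFieldFamily p hp.out).k (e b))
              (logPacket p (fun b => (σ.localFieldFamily p hp.out).k (e b)) :
                Set (PacketAlgebra p (fun b => (σ.localFieldFamily p hp.out).k (e b)))))) *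
          ∏ b, weight F₀ (e b).1 -
        ((l : ℝ) + 1) * l / 12 * ((M : ℝ) * Real.log p) := by
    intro M hM
    have hc := (ThetaVolumeInput.deepAt p l hl h5 M hM σ).negLogThetaLoc_eq_of_content p
      (fun i e => m₀ i e + ((((i : ℕ) + 1) ^ 2 * M : ℕ) : ℤ)) (fun i e => ⟨?_, fun h => ?_⟩)
    rotate_left
    · exact (slotUnion_deepAt_eq p l hl h5 σ M hM i e).subset.trans
        (content_shift p _ ((((i : ℕ) + 1) ^ 2 * M : ℕ) : ℤ) (hm₀ i e) (hm₀' i e)).1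
    · exact (content_shift p _ ((((i : ℕ) + 1) ^ 2 * M : ℕ) : ℤ) (hm₀ i e) (hm₀' i e)).2
        ((slotUnion_deepAt_eq p l hl h5 σ M hM i e).symm.subset.trans h)
    have hc' : (ThetaVolumeInput.deepAt p l hl h5 M hM σ).negLogThetaLoc p =
        (1 / (((l - 1) / 2 : ℕ) : ℝ)) * ∑ i : Fin ((l - 1) / 2), ∑ e : Fin ((i : ℕ) + 1 + 1) → placesOver F₀ p,
          (-(((m₀ i e + ((((i : ℕ) + 1) ^ 2 * M : ℕ) : ℤ) : ℤ) : ℝ) * Real.log p) +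
            packetLogμ p (fun b => (σ.localFieldFamily p hp.out).k (e b))
              (packetHull p (fun b => (σ.localFieldFamily p hp.out).k (e b))
                (logPacket p (fun b => (σ.localFieldFamily p hp.out).k (e b)) :
                  Set (PacketAlgebra p (fun b => (σ.localFieldFamily p hp.out).k (e b)))))) *
            ∏ b, weight F₀ (e b).1 := hc
    rw [hc', Finset.sum_congr rfl fun i _ => Finset.sum_congr rfl fun e _ => hterm i M (m₀ i e) _ _]
    simp only [Finset.sum_sub_distrib]
    simp only [← Finset.mul_sum, hW, mul_one]
    rw [mul_sub, ← Finset.sum_mul, ← mul_assoc, avg_sum_sq_eq l hl h5]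
  rw [key N hN, key N' hN']
  ring

/-- **At every prime other than the deep one the summand does not move with the depth** (the synthetic Θ-idele is `1` there).
[cite: DupuyHilado2025, §3.9, Def. 3.6.3] -/
theorem negLogThetaLoc_deepAt_eq_of_ne (N N' : ℕ) (hN : 0 < N) (hN' : 0 < N') {p' : ℕ} (hp' : p' ≠ p) :
    (ThetaVolumeInput.deepAt p l hl h5 N hN σ).negLogThetaLoc p' =
      (ThetaVolumeInput.deepAt p l hl h5 N' hN' σ).negLogThetaLoc p' := by
  by_cases hpr : p'.Prime
  · haveI : Fact p'.Prime := ⟨hpr⟩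
    rw [(ThetaVolumeInput.deepAt p l hl h5 N hN σ).negLogThetaLoc_of_prime hpr,
      (ThetaVolumeInput.deepAt p l hl h5 N' hN' σ).negLogThetaLoc_of_prime hpr]
    have ht : (ThetaVolumeInput.deepAt p l hl h5 N hN σ).tΘ p' hpr =
        (ThetaVolumeInput.deepAt p l hl h5 N' hN' σ).tΘ p' hpr := by
      funext i v
      have hv : v.1 ∉ placesOver F₀ p := fun h => hp'
        (((mem_placesOver_iff_residueChar v.1).mp v.2).symm.trans ((mem_placesOver_iff_residueChar v.1).mp h))
      dsimp only [ThetaVolumeInput.deepAt]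
      rw [if_neg hv, if_neg hv]
    exact congrArg (fun t => ((ThetaVolumeInput.deepAt p l hl h5 N hN σ).packetAt p' hpr).negLogThetaAt
      ((l - 1) / 2) t) ht
  · rw [ThetaVolumeInput.negLogThetaLoc, ThetaVolumeInput.negLogThetaLoc, dif_neg hpr, dif_neg hpr]

/-- The deep prime is a support prime of the synthetic input. [cite: DupuyHilado2025, §3.9] -/
theorem mem_supportPrimes_deepAt (N : ℕ) (hN : 0 < N) :
    p ∈ (ThetaVolumeInput.deepAt p l hl h5 N hN σ).supportPrimes := by
  obtain ⟨v, hv⟩ := placesOver_nonempty F₀ p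
  have h := (ThetaVolumeInput.deepAt p l hl h5 N hN σ).residueChar_mem_supportPrimes (v := v) hv
  rwa [(mem_placesOver_iff_residueChar v).mp hv] at h

/-- **`−|log(Θ)|^nonarch` IS EXACTLY AFFINE IN THE DEPTH**: for every `F₀, K, σ`, `p`, prime `l ≥ 5`, `N, N' ≥ 1`,
`negLogThetaNonarch (deepAt p l N σ) − negLogThetaNonarch (deepAt p l N' σ) = −((l+1)l/12)·(N − N')·log p`.
[cite: DupuyHilado2025, §1 (1.1), Def. 3.6.3] [claim: Mochizuki2012, status: disputed] -/
theorem negLogThetaNonarch_deepAt_sub (N N' : ℕ) (hN : 0 < N) (hN' : 0 < N') :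
    (ThetaVolumeInput.deepAt p l hl h5 N hN σ).negLogThetaNonarch -
        (ThetaVolumeInput.deepAt p l hl h5 N' hN' σ).negLogThetaNonarch =
      -(((l : ℝ) + 1) * l / 12 * (((N : ℝ) - N') * Real.log p)) := by
  classical
  have hT : (ThetaVolumeInput.deepAt p l hl h5 N' hN' σ).supportPrimes =
      (ThetaVolumeInput.deepAt p l hl h5 N hN σ).supportPrimes := rfl
  unfold ThetaVolumeInput.negLogThetaNonarch
  rw [hT, ← Finset.sum_sub_distrib, Finset.sum_eq_single_of_mem p (mem_supportPrimes_deepAt p l hl h5 σ N hN)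
    (fun p' _ hp' => by rw [negLogThetaLoc_deepAt_eq_of_ne p l hl h5 σ N N' hN hN' hp', sub_self])]
  exact negLogThetaLoc_deepAt_sub p l hl h5 σ N N' hN hN'

/-- **`−|log(Θ)|` along the family**: `negLogTheta (deepAt N) = negLogTheta (deepAt 1) − ((l+1)l/12)·(N−1)·log p` (the archimedean
term `((l+5)/4)·log π` is depth-free). [cite: Mochizuki2012, IUTchIV Thm. 1.10 Step (vii) p. 30] [claim: Mochizuki2012, status: disputed] -/
theorem negLogTheta_deepAt_eq (N : ℕ) (hN : 0 < N) :
    (ThetaVolumeInput.deepAt p l hl h5 N hN σ).negLogTheta =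
      (ThetaVolumeInput.deepAt p l hl h5 1 Nat.one_pos σ).negLogTheta -
        ((l : ℝ) + 1) * l / 12 * (((N : ℝ) - 1) * Real.log p) := by
  have h := negLogThetaNonarch_deepAt_sub p l hl h5 σ N 1 hN Nat.one_pos
  have ha : ThetaVolumeInput.archLogTheta (ThetaVolumeInput.deepAt p l hl h5 N hN σ).l =
      ThetaVolumeInput.archLogTheta (ThetaVolumeInput.deepAt p l hl h5 1 Nat.one_pos σ).l := rfl
  unfold ThetaVolumeInput.negLogTheta
  push_cast at h
  linarith

/-- **THE THRESHOLD LAW.** For every `F₀, K, σ`, prime `p`, prime `l ≥ 5` and depth `N ≥ 1`: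
`Cor312Of (deepAt p l N σ) ↔ ((l+1)l/12 − 1)·N·log p ≤ negLogTheta (deepAt p l 1 σ) + ((l+1)l/12)·log p` — the typed inequality of
[IUTchIII] Cor. 3.12 along the synthetic family holds EXACTLY while the linear gap `deĝ̲_lgp(P_Θ) − deĝ̲(P_q) = ((l+1)l/12 − 1)·N·log p`
stays below a constant of `(σ, p, l)` (the depth-one `−|log(Θ)|`, re-centred). HYPOTHESIS-shaped on the left; synthetic input; no side
taken. [cite: Mochizuki2012, IUTchIII Cor. 3.12 p. 173–174] [cite: DupuyHilado2025, §1 (1.1), Thm. 3.10.1] [claim: Mochizuki2012, status: disputed] -/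
theorem cor312Of_deepAt_iff (N : ℕ) (hN : 0 < N) :
    (ThetaVolumeInput.deepAt p l hl h5 N hN σ).Cor312Of ↔
      (((l : ℝ) + 1) * l / 12 - 1) * ((N : ℝ) * Real.log p) ≤
        (ThetaVolumeInput.deepAt p l hl h5 1 Nat.one_pos σ).negLogTheta + ((l : ℝ) + 1) * l / 12 * Real.log p := by
  unfold ThetaVolumeInput.Cor312Of
  rw [ThetaVolumeInput.deepAt_negAbsLogQ' p l hl h5 N hN σ, negLogTheta_deepAt_eq p l hl h5 σ N hN]
  constructor <;> intro h <;> linarith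

include h5 in
/-- The slope is positive: `((l+1)l/12 − 1)·log p > 0` for `l ≥ 5`, `p ≥ 2`. [cite: DupuyHilado2025, §3.3] -/
theorem slope_pos : 0 < (((l : ℝ) + 1) * l / 12 - 1) * Real.log p := by
  have hl5 : (5 : ℝ) ≤ l := by exact_mod_cast h5
  have hp2 : (2 : ℝ) ≤ p := by exact_mod_cast hp.out.two_le
  have hlog : 0 < Real.log p := Real.log_pos (by linarith)
  have : 0 < ((l : ℝ) + 1) * l / 12 - 1 := by nlinarith
  positivity

/-- **Threshold form**: `Cor312Of (deepAt p l N σ) ↔ N ≤ N₀(p,l,σ)` with the real threshold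
`N₀ = (negLogTheta (deepAt p l 1 σ) + ((l+1)l/12)·log p) / (((l+1)l/12 − 1)·log p)`.
[cite: Mochizuki2012, IUTchIII Cor. 3.12 p. 173–174] [claim: Mochizuki2012, status: disputed] -/
theorem cor312Of_deepAt_iff_le_threshold (N : ℕ) (hN : 0 < N) :
    (ThetaVolumeInput.deepAt p l hl h5 N hN σ).Cor312Of ↔
      (N : ℝ) ≤ ((ThetaVolumeInput.deepAt p l hl h5 1 Nat.one_pos σ).negLogTheta + ((l : ℝ) + 1) * l / 12 * Real.log p) /
        ((((l : ℝ) + 1) * l / 12 - 1) * Real.log p) := by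
  rw [cor312Of_deepAt_iff, le_div_iff₀ (slope_pos p l h5)]
  constructor <;> intro h <;> linarith

/-- **The typed inequality is ANTITONE in the depth**: if it holds at depth `N` it holds at every depth `N' ≤ N`.
[cite: Mochizuki2012, IUTchIII Cor. 3.12 p. 173–174] [claim: Mochizuki2012, status: disputed] -/
theorem cor312Of_deepAt_anti {N N' : ℕ} (hN : 0 < N) (hN' : 0 < N') (hle : N' ≤ N)
    (h : (ThetaVolumeInput.deepAt p l hl h5 N hN σ).Cor312Of) :
    (ThetaVolumeInput.deepAt p l hl h5 N' hN' σ).Cor312Of := by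
  rw [cor312Of_deepAt_iff] at h ⊢
  have hle' : (N' : ℝ) ≤ N := by exact_mod_cast hle
  have hs := slope_pos p l h5
  nlinarith

/-- **ONE CROSSING: an exact natural-number threshold.** For every `F₀, K, σ, p`, prime `l ≥ 5` there is `N₀ : ℕ` with
`Cor312Of (deepAt p l N σ) ↔ N ≤ N₀` for every depth `N ≥ 1` (the typed inequality holds at the depths `1, …, N₀` and fails at every
depth `> N₀`; `N₀ = 0` is allowed). [cite: Mochizuki2012, IUTchIII Cor. 3.12 p. 173–174] [claim: Mochizuki2012, status: disputed] -/
theorem exists_nat_threshold :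
    ∃ N₀ : ℕ, ∀ (N : ℕ) (hN : 0 < N), (ThetaVolumeInput.deepAt p l hl h5 N hN σ).Cor312Of ↔ N ≤ N₀ := by
  set T : ℝ := ((ThetaVolumeInput.deepAt p l hl h5 1 Nat.one_pos σ).negLogTheta + ((l : ℝ) + 1) * l / 12 * Real.log p) /
    ((((l : ℝ) + 1) * l / 12 - 1) * Real.log p) with hT
  refine ⟨⌊T⌋₊, fun N hN => ?_⟩
  rw [cor312Of_deepAt_iff_le_threshold, ← hT]
  refine ⟨fun h => Nat.le_floor h, fun h => ?_⟩
  by_cases hT0 : 0 ≤ T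
  · exact (Nat.cast_le.mpr h).trans (Nat.floor_le hT0)
  · rw [Nat.floor_of_nonpos (le_of_lt (not_le.mp hT0))] at h
    omega

/-- **The deep side with its exact rate** (abc-iut-w5-d157's `exists_deepAt_not_cor312Of'` recovered): the typed inequality FAILS at
every depth beyond the real threshold. [cite: DupuyHilado2025, §1 (1.1), Thm. 3.10.1] [claim: Mochizuki2012, status: disputed] -/
theorem not_cor312Of_deepAt_of_threshold_lt (N : ℕ) (hN : 0 < N)
    (h : ((ThetaVolumeInput.deepAt p l hl h5 1 Nat.one_pos σ).negLogTheta + ((l : ℝ) + 1) * l / 12 * Real.log p) /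
        ((((l : ℝ) + 1) * l / 12 - 1) * Real.log p) < N) :
    ¬ (ThetaVolumeInput.deepAt p l hl h5 N hN σ).Cor312Of := by
  rw [cor312Of_deepAt_iff_le_threshold]
  exact not_le.mpr h

/-- **At `(l, p) = (5, 2)` the crossing point is at least `1`, for every `F₀, K, σ`**: `∃ N₀ ≥ 1, ∀ N ≥ 1,
Cor312Of (deepAt 2 5 N σ) ↔ N ≤ N₀` (skel gen 7's `cor312Of_deepAt_five_two_one` puts depth `1` on the TRUE side).
[cite: Mochizuki2012, IUTchIII Cor. 3.12 p. 173–174] [claim: Mochizuki2012, status: disputed] -/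
theorem exists_pos_nat_threshold_five_two :
    ∃ N₀ : ℕ, 0 < N₀ ∧ ∀ (N : ℕ) (hN : 0 < N),
      ((ThetaVolumeInput.deepAt 2 5 Nat.prime_five le_rfl N hN σ).Cor312Of ↔ N ≤ N₀) := by
  obtain ⟨N₀, hN₀⟩ := exists_nat_threshold 2 5 Nat.prime_five le_rfl σ
  exact ⟨N₀, (hN₀ 1 Nat.one_pos).mp (cor312Of_deepAt_five_two_one σ), hN₀⟩

/-- **The same at `(l, p) = (5, 3)` and `(7, 2)`** (skel gen 7's instances). [cite: Mochizuki2012, IUTchIII Cor. 3.12 p. 173–174]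
[claim: Mochizuki2012, status: disputed] -/
theorem exists_pos_nat_threshold_five_three_and_seven_two :
    (∃ N₀ : ℕ, 0 < N₀ ∧ ∀ (N : ℕ) (hN : 0 < N),
      ((ThetaVolumeInput.deepAt 3 5 Nat.prime_five le_rfl N hN σ).Cor312Of ↔ N ≤ N₀)) ∧
    (∃ N₀ : ℕ, 0 < N₀ ∧ ∀ (N : ℕ) (hN : 0 < N),
      ((ThetaVolumeInput.deepAt 2 7 (by norm_num) (by norm_num) N hN σ).Cor312Of ↔ N ≤ N₀)) := by
  refine ⟨?_, ?_⟩
  · obtain ⟨N₀, hN₀⟩ := exists_nat_threshold 3 5 Nat.prime_five le_rfl σ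
    exact ⟨N₀, (hN₀ 1 Nat.one_pos).mp (cor312Of_deepAt_five_three_one σ), hN₀⟩
  · obtain ⟨N₀, hN₀⟩ := exists_nat_threshold 2 7 (by norm_num) (by norm_num) σ
    exact ⟨N₀, (hN₀ 1 Nat.one_pos).mp (cor312Of_deepAt_seven_two_one σ), hN₀⟩

end DepthThreshold

end Summit.ABC.IUTFork.GenuineContent

end
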